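import Mathlib
import Summits.PneNP.PneNP.Theorems.CnfIdealGenLengthRankDefectRepresentationsMergeLowerBound
import Summits.PneNP.PneNP.Theorems.CnfIdealGenLengthRankDefectRepresentationsPolyOfAbsoluteMergeLevels

/-!
# Crux `RankDefectRepresentations` (stmt-PneNP-18923), line `cell-union-merge`: the polynomial bookkeeping,
# part 2 — merge step, iteration, assembly (registered stub `stub_polyOfAbsoluteMerge`, brief §B3 of
# `Lines/cell-union-merge-briefs.md`)

`AbsoluteMerge lam` (AMB: two complete orthogonal systems of idempotents whose cell unions almost commute are,
union by union, within rank `lam·c` of a COMMUTING pair of complete orthogonal systems) together with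
`JointCutLemma κ` (JCL: for a commuting pair `P, Q` and an observer `G` almost commuting with every `P`-union
(`≤ u`) and every `Q`-union (`≤ v`), every union of JOINT cells almost commutes with `G`, `≤ κ(u+v)`) imply
generator-form N0b (`PolyStableIdem`): `n` idempotents with pairwise commutator ranks `≤ t` are, eventually in
`n` and uniformly in the characteristic-0 field, the dimension and `t`, within rank `n^a·t` of commuting
idempotents.

Proof (memo §3.T3, the dyadic two-invariant recursion), with the family-level statement of part 1
(`…PolyOfAbsoluteMergeLevels`: `level_zero`, `level_transport`):
* successor (`level_succ`): from `(G, X, A, C, U)` to `(G ⊕ G, X × X, A⁺, C + lam·U, θ·U)` with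
  `θ = 2κ(2κ(1+2·lam)+2·lam)`: view the halves of a family of `(G ⊕ G)`-blocks as ONE family of `G`-blocks
  indexed by `M × Bool`, merge the two halves of each block by AMB (`c = U·t`, licensed by the pairwise-blocks
  cross bound), take the product system `R m (x,y) = P' m x * Q' m y`; the cross bound is JCL twice (observer =
  a joint union of the other merged block, then observer = an old union), exactly as in the brief;
* iteration along `Fin 2^(k+1) ≃ Fin 2^k ⊕ Fin 2^k` (`level_all`): `C_k ≤ lam·k·B^k`, `U_k ≤ B^k`, `B = θ + 1`;
* assembly (`stub_polyOfAbsoluteMerge`): `L = log₂ n + 1`, pull back to `Fin n` (padding), `E'_i :=` the union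
  of the cells under `E_i` (idempotent and commuting since unions of one exact system multiply by
  intersection), and `lam·L·B^L ≤ n^{B+2}` for `n ≥ lam·B + 1` (`final_bound`).
All arithmetic is in `ℕ`.  HONEST FRAMING: conditional bookkeeping in the negative lane (closing N0b REFUTES the
crux); P ≠ NP is not moved; F-N2 is a FRONTIER formal rung.
-/

set_option linter.dupNamespace false -- `Summit.PneNP.PneNP.…`: summit = sub-problem name (D-0017)

namespace Summit.PneNP.PneNP.Theorems.CnfIdealGenLengthRankDefectRepresentationsPolyOfAbsoluteMerge

open Filter Matrix
open Summit.PneNP.PneNP.Theorems.CnfIdealGenLengthRankDefectRepresentationsMergeLowerBound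
  (rank_add_le' rank_neg' rank_sub_le')
open Summit.PneNP.PneNP.Theorems.CnfIdealGenLengthRankDefectRepresentationsPolyOfAbsoluteMergeLevels

variable {K : Type} [Field K] {d : ℕ}

/-- **Successor level** (the merge step).  From the level statement for `(G, X, A, C, U)` to the one for
`(G ⊕ G, X × X, A⁺, C + lam·U, θ·U)`, `θ = 2κ(2κ(1+2·lam)+2·lam)`, `A⁺ (inl g) = A g × univ`,
`A⁺ (inr g) = univ × A g`: the halves of a family of `(G ⊕ G)`-blocks form ONE family of `G`-blocks indexed by
`M × Bool`; merge the two halves of each block by AMB (`c = U·t`, licensed by the cross bound of the pair) and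
take the product system; the cost grows by `lam·U·t`; the new cross bound is JCL twice. -/
theorem level_succ (lam κ : ℕ)
    (hA : ∀ (K : Type) [Field K] [CharZero K] (d : ℕ) (X Y : Type) [Fintype X] [Fintype Y]
      (P : X → Matrix (Fin d) (Fin d) K) (Q : Y → Matrix (Fin d) (Fin d) K) (c : ℕ),
      (∀ x, P x * P x = P x) → (∀ x x', x ≠ x' → P x * P x' = 0) → ∑ x, P x = 1 →
      (∀ y, Q y * Q y = Q y) → (∀ y y', y ≠ y' → Q y * Q y' = 0) → ∑ y, Q y = 1 →
      (∀ (A : Finset X) (B : Finset Y),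
        ((∑ x ∈ A, P x) * (∑ y ∈ B, Q y) - (∑ y ∈ B, Q y) * (∑ x ∈ A, P x)).rank ≤ c) →
      ∃ (P' : X → Matrix (Fin d) (Fin d) K) (Q' : Y → Matrix (Fin d) (Fin d) K),
        (∀ x, P' x * P' x = P' x) ∧ (∀ x x', x ≠ x' → P' x * P' x' = 0) ∧ ∑ x, P' x = 1 ∧
        (∀ y, Q' y * Q' y = Q' y) ∧ (∀ y y', y ≠ y' → Q' y * Q' y' = 0) ∧ ∑ y, Q' y = 1 ∧
        (∀ x y, P' x * Q' y = Q' y * P' x) ∧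
        (∀ A : Finset X, ((∑ x ∈ A, P x) - ∑ x ∈ A, P' x).rank ≤ lam * c) ∧
        (∀ B : Finset Y, ((∑ y ∈ B, Q y) - ∑ y ∈ B, Q' y).rank ≤ lam * c))
    (hJ : ∀ (K : Type) [Field K] (d : ℕ) (X Y : Type) [Fintype X] [Fintype Y]
      (P : X → Matrix (Fin d) (Fin d) K) (Q : Y → Matrix (Fin d) (Fin d) K) (G : Matrix (Fin d) (Fin d) K)
      (u v : ℕ),
      (∀ x, P x * P x = P x) → (∀ x x', x ≠ x' → P x * P x' = 0) → ∑ x, P x = 1 →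
      (∀ y, Q y * Q y = Q y) → (∀ y y', y ≠ y' → Q y * Q y' = 0) → ∑ y, Q y = 1 →
      (∀ x y, P x * Q y = Q y * P x) →
      (∀ A : Finset X, ((∑ x ∈ A, P x) * G - G * ∑ x ∈ A, P x).rank ≤ u) →
      (∀ B : Finset Y, ((∑ y ∈ B, Q y) * G - G * ∑ y ∈ B, Q y).rank ≤ v) →
      ∀ C : Finset (X × Y),
        ((∑ p ∈ C, P p.1 * Q p.2) * G - G * ∑ p ∈ C, P p.1 * Q p.2).rank ≤ κ * (u + v))
    [CharZero K] (t C U : ℕ) {G X : Type} [Fintype X] (A : G → Finset X)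
    (h : ∀ (M : Type) (E : M → G → Matrix (Fin d) (Fin d) K),
      (∀ m g, E m g * E m g = E m g) →
      (∀ m m' g g', (E m g * E m' g' - E m' g' * E m g).rank ≤ t) →
      ∃ P : M → X → Matrix (Fin d) (Fin d) K,
        (∀ m x, P m x * P m x = P m x) ∧
        (∀ m x x', x ≠ x' → P m x * P m x' = 0) ∧
        (∀ m, ∑ x, P m x = 1) ∧
        (∀ m g, (E m g - ∑ x ∈ A g, P m x).rank ≤ C * t) ∧
        (∀ m m' (S T : Finset X),
          ((∑ x ∈ S, P m x) * (∑ x ∈ T, P m' x) - (∑ x ∈ T, P m' x) * (∑ x ∈ S, P m x)).rank ≤ U * t)) :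
    ∀ (M : Type) (E : M → G ⊕ G → Matrix (Fin d) (Fin d) K),
      (∀ m g, E m g * E m g = E m g) →
      (∀ m m' g g', (E m g * E m' g' - E m' g' * E m g).rank ≤ t) →
      ∃ P : M → X × X → Matrix (Fin d) (Fin d) K,
        (∀ m x, P m x * P m x = P m x) ∧
        (∀ m x x', x ≠ x' → P m x * P m x' = 0) ∧
        (∀ m, ∑ x, P m x = 1) ∧
        (∀ m g, (E m g - ∑ x ∈ Sum.elim (fun g => A g ×ˢ (Finset.univ : Finset X))
            (fun g => (Finset.univ : Finset X) ×ˢ A g) g, P m x).rank ≤ (C + lam * U) * t) ∧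
        (∀ m m' (S T : Finset (X × X)),
          ((∑ x ∈ S, P m x) * (∑ x ∈ T, P m' x) - (∑ x ∈ T, P m' x) * (∑ x ∈ S, P m x)).rank ≤
            2 * κ * (2 * κ * (1 + 2 * lam) + 2 * lam) * U * t) := by
  intro M E hE hc
  -- the halves, as ONE level-`k` family indexed by `M × Bool` (`false` = left half, `true` = right half)
  obtain ⟨P, hPid, hPor, hPsum, hPcost, hPcross⟩ :=
    h (M × Bool) (fun mb g => E mb.1 (bif mb.2 then Sum.inr g else Sum.inl g))
      (fun mb g => hE _ _) (fun mb mb' g g' => hc _ _ _ _)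
  -- merge the two halves of each block by AMB with `c := U * t`
  have hmerge : ∀ m : M, ∃ (P' Q' : X → Matrix (Fin d) (Fin d) K),
      (∀ x, P' x * P' x = P' x) ∧ (∀ x x', x ≠ x' → P' x * P' x' = 0) ∧ ∑ x, P' x = 1 ∧
      (∀ y, Q' y * Q' y = Q' y) ∧ (∀ y y', y ≠ y' → Q' y * Q' y' = 0) ∧ ∑ y, Q' y = 1 ∧
      (∀ x y, P' x * Q' y = Q' y * P' x) ∧
      (∀ S : Finset X, ((∑ x ∈ S, P (m, false) x) - ∑ x ∈ S, P' x).rank ≤ lam * (U * t)) ∧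
      (∀ S : Finset X, ((∑ x ∈ S, P (m, true) x) - ∑ x ∈ S, Q' x).rank ≤ lam * (U * t)) :=
    fun m => hA K d X X (P (m, false)) (P (m, true)) (U * t)
      (hPid _) (hPor _) (hPsum _) (hPid _) (hPor _) (hPsum _) (fun S T => hPcross _ _ S T)
  choose P' Q' hP'id hP'or hP'sum hQ'id hQ'or hQ'sum hcomm hP'cost hQ'cost using hmerge
  refine ⟨fun m p => P' m p.1 * Q' m p.2, ?_, ?_, ?_, ?_, ?_⟩
  · exact fun m p => prod_cells_idem (P' m) (Q' m) (hP'id m) (hQ'id m) (hcomm m) p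
  · exact fun m p q hpq => prod_cells_orth (P' m) (Q' m) (hP'or m) (hQ'or m) (hcomm m) p q hpq
  · exact fun m => prod_cells_sum (P' m) (Q' m) (hP'sum m) (hQ'sum m)
  · -- cost: a half-cylinder of the product system is a union of the merged half-system
    intro m g
    cases g with
    | inl g =>
        show (E m (Sum.inl g) -
            ∑ p ∈ A g ×ˢ (Finset.univ : Finset X), P' m p.1 * Q' m p.2).rank ≤ (C + lam * U) * t
        rw [prod_cells_sum_fst (P' m) (Q' m) (hQ'sum m)]
        calc (E m (Sum.inl g) - ∑ x ∈ A g, P' m x).rank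
            ≤ (E m (Sum.inl g) - ∑ x ∈ A g, P (m, false) x).rank +
                ((∑ x ∈ A g, P (m, false) x) - ∑ x ∈ A g, P' m x).rank := rank_sub_triangle _ _ _
          _ ≤ C * t + lam * (U * t) := Nat.add_le_add (hPcost (m, false) g) (hP'cost m (A g))
          _ = (C + lam * U) * t := by ring
    | inr g =>
        show (E m (Sum.inr g) -
            ∑ p ∈ (Finset.univ : Finset X) ×ˢ A g, P' m p.1 * Q' m p.2).rank ≤ (C + lam * U) * t
        rw [prod_cells_sum_snd (P' m) (Q' m) (hP'sum m)]
        calc (E m (Sum.inr g) - ∑ x ∈ A g, Q' m x).rank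
            ≤ (E m (Sum.inr g) - ∑ x ∈ A g, P (m, true) x).rank +
                ((∑ x ∈ A g, P (m, true) x) - ∑ x ∈ A g, Q' m x).rank := rank_sub_triangle _ _ _
          _ ≤ C * t + lam * (U * t) := Nat.add_le_add (hPcost (m, true) g) (hQ'cost m (A g))
          _ = (C + lam * U) * t := by ring
  · -- cross: JCL twice
    intro m m' S T
    -- JCL for the merged pair of block `m₁` against an observer `G₁` controlled through the OLD halves
    have key : ∀ (m₁ : M) (G₁ : Matrix (Fin d) (Fin d) K) (s : ℕ),
        (∀ S₁ : Finset X,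
          ((∑ x ∈ S₁, P (m₁, false) x) * G₁ - G₁ * ∑ x ∈ S₁, P (m₁, false) x).rank ≤ s) →
        (∀ S₁ : Finset X,
          ((∑ x ∈ S₁, P (m₁, true) x) * G₁ - G₁ * ∑ x ∈ S₁, P (m₁, true) x).rank ≤ s) →
        ∀ T₁ : Finset (X × X),
          ((∑ p ∈ T₁, P' m₁ p.1 * Q' m₁ p.2) * G₁ - G₁ * ∑ p ∈ T₁, P' m₁ p.1 * Q' m₁ p.2).rank ≤
            κ * ((s + (lam * (U * t) + lam * (U * t))) + (s + (lam * (U * t) + lam * (U * t)))) := by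
      intro m₁ G₁ s h0 h1 T₁
      refine hJ K d X X (P' m₁) (Q' m₁) G₁ _ _ (hP'id m₁) (hP'or m₁) (hP'sum m₁) (hQ'id m₁)
        (hQ'or m₁) (hQ'sum m₁) (hcomm m₁) ?_ ?_ T₁
      · intro S₁
        exact (rank_comm_perturb _ _ G₁).trans
          (Nat.add_le_add (h0 S₁) (Nat.add_le_add (hP'cost m₁ S₁) (hP'cost m₁ S₁)))
      · intro S₁
        exact (rank_comm_perturb _ _ G₁).trans
          (Nat.add_le_add (h1 S₁) (Nat.add_le_add (hQ'cost m₁ S₁) (hQ'cost m₁ S₁)))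
    -- first use: the merged union of block `m'` against an OLD union of block `m` (cross bound of level `k`)
    have step1 : ∀ (b : Bool) (S₁ : Finset X),
        ((∑ x ∈ S₁, P (m, b) x) * (∑ p ∈ T, P' m' p.1 * Q' m' p.2) -
          (∑ p ∈ T, P' m' p.1 * Q' m' p.2) * ∑ x ∈ S₁, P (m, b) x).rank ≤
          κ * ((U * t + (lam * (U * t) + lam * (U * t))) + (U * t + (lam * (U * t) + lam * (U * t)))) := by
      intro b S₁
      rw [rank_comm_symm]
      exact key m' _ (U * t) (fun S₂ => hPcross _ _ S₂ S₁) (fun S₂ => hPcross _ _ S₂ S₁) T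
    -- second use: the merged union of block `m` against the merged union of block `m'`
    have step2 := key m (∑ p ∈ T, P' m' p.1 * Q' m' p.2) _
      (fun S₁ => step1 false S₁) (fun S₁ => step1 true S₁) S
    refine step2.trans (le_of_eq ?_)
    ring

/-- **All levels** (iteration along `Fin 2^(k+1) ≃ Fin 2^k ⊕ Fin 2^k`): at level `k` there are a cell type and a
union map with constants `C_k ≤ lam·k·B^k`, `U_k ≤ B^k`, `B = θ + 1`. -/
theorem level_all (lam κ : ℕ)
    (hA : ∀ (K : Type) [Field K] [CharZero K] (d : ℕ) (X Y : Type) [Fintype X] [Fintype Y]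
      (P : X → Matrix (Fin d) (Fin d) K) (Q : Y → Matrix (Fin d) (Fin d) K) (c : ℕ),
      (∀ x, P x * P x = P x) → (∀ x x', x ≠ x' → P x * P x' = 0) → ∑ x, P x = 1 →
      (∀ y, Q y * Q y = Q y) → (∀ y y', y ≠ y' → Q y * Q y' = 0) → ∑ y, Q y = 1 →
      (∀ (A : Finset X) (B : Finset Y),
        ((∑ x ∈ A, P x) * (∑ y ∈ B, Q y) - (∑ y ∈ B, Q y) * (∑ x ∈ A, P x)).rank ≤ c) →
      ∃ (P' : X → Matrix (Fin d) (Fin d) K) (Q' : Y → Matrix (Fin d) (Fin d) K),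
        (∀ x, P' x * P' x = P' x) ∧ (∀ x x', x ≠ x' → P' x * P' x' = 0) ∧ ∑ x, P' x = 1 ∧
        (∀ y, Q' y * Q' y = Q' y) ∧ (∀ y y', y ≠ y' → Q' y * Q' y' = 0) ∧ ∑ y, Q' y = 1 ∧
        (∀ x y, P' x * Q' y = Q' y * P' x) ∧
        (∀ A : Finset X, ((∑ x ∈ A, P x) - ∑ x ∈ A, P' x).rank ≤ lam * c) ∧
        (∀ B : Finset Y, ((∑ y ∈ B, Q y) - ∑ y ∈ B, Q' y).rank ≤ lam * c))
    (hJ : ∀ (K : Type) [Field K] (d : ℕ) (X Y : Type) [Fintype X] [Fintype Y]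
      (P : X → Matrix (Fin d) (Fin d) K) (Q : Y → Matrix (Fin d) (Fin d) K) (G : Matrix (Fin d) (Fin d) K)
      (u v : ℕ),
      (∀ x, P x * P x = P x) → (∀ x x', x ≠ x' → P x * P x' = 0) → ∑ x, P x = 1 →
      (∀ y, Q y * Q y = Q y) → (∀ y y', y ≠ y' → Q y * Q y' = 0) → ∑ y, Q y = 1 →
      (∀ x y, P x * Q y = Q y * P x) →
      (∀ A : Finset X, ((∑ x ∈ A, P x) * G - G * ∑ x ∈ A, P x).rank ≤ u) →
      (∀ B : Finset Y, ((∑ y ∈ B, Q y) * G - G * ∑ y ∈ B, Q y).rank ≤ v) →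
      ∀ C : Finset (X × Y),
        ((∑ p ∈ C, P p.1 * Q p.2) * G - G * ∑ p ∈ C, P p.1 * Q p.2).rank ≤ κ * (u + v))
    [CharZero K] (t k : ℕ) :
    ∃ (X : Type) (_ : Fintype X) (A : Fin (2 ^ k) → Finset X),
    ∀ (M : Type) (E : M → Fin (2 ^ k) → Matrix (Fin d) (Fin d) K),
      (∀ m g, E m g * E m g = E m g) →
      (∀ m m' g g', (E m g * E m' g' - E m' g' * E m g).rank ≤ t) →
      ∃ P : M → X → Matrix (Fin d) (Fin d) K,
        (∀ m x, P m x * P m x = P m x) ∧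
        (∀ m x x', x ≠ x' → P m x * P m x' = 0) ∧
        (∀ m, ∑ x, P m x = 1) ∧
        (∀ m g, (E m g - ∑ x ∈ A g, P m x).rank ≤
          lam * k * (2 * κ * (2 * κ * (1 + 2 * lam) + 2 * lam) + 1) ^ k * t) ∧
        (∀ m m' (S T : Finset X),
          ((∑ x ∈ S, P m x) * (∑ x ∈ T, P m' x) - (∑ x ∈ T, P m' x) * (∑ x ∈ S, P m x)).rank ≤
            (2 * κ * (2 * κ * (1 + 2 * lam) + 2 * lam) + 1) ^ k * t) := by
  induction k with
  | zero =>
      refine ⟨Bool, inferInstance, fun _ => {true}, ?_⟩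
      have h0 := level_zero (K := K) (d := d) t
      have hf : Function.Injective (fun _ : Fin (2 ^ 0) => ()) := fun a b _ =>
        Fin.ext (by have ha := a.2; have hb := b.2; simp only [pow_zero] at ha hb; omega)
      exact level_transport (fun _ : Unit => ({true} : Finset Bool)) (fun _ : Fin (2 ^ 0) => ()) hf
        (by simp) (by simp) h0
  | succ k ih =>
      obtain ⟨X, instX, A, hk⟩ := ih
      have hs := level_succ (K := K) (d := d) lam κ hA hJ t _ _ A hk
      have e : Fin (2 ^ (k + 1)) ≃ Fin (2 ^ k) ⊕ Fin (2 ^ k) :=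
        (finCongr (by ring)).trans finSumFinEquiv.symm
      refine ⟨X × X, inferInstance, fun i => Sum.elim (fun g => A g ×ˢ (Finset.univ : Finset X))
        (fun g => (Finset.univ : Finset X) ×ˢ A g) (e i), ?_⟩
      refine level_transport _ e e.injective ?_ ?_ hs
      · -- `lam k B^k + lam B^k ≤ lam (k+1) B^(k+1)`
        have hB : 0 < 2 * κ * (2 * κ * (1 + 2 * lam) + 2 * lam) + 1 := Nat.succ_pos _
        calc lam * k * (2 * κ * (2 * κ * (1 + 2 * lam) + 2 * lam) + 1) ^ k +
              lam * (2 * κ * (2 * κ * (1 + 2 * lam) + 2 * lam) + 1) ^ k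
            = lam * (k + 1) * (2 * κ * (2 * κ * (1 + 2 * lam) + 2 * lam) + 1) ^ k := by ring
          _ ≤ lam * (k + 1) * (2 * κ * (2 * κ * (1 + 2 * lam) + 2 * lam) + 1) ^ k *
                (2 * κ * (2 * κ * (1 + 2 * lam) + 2 * lam) + 1) := Nat.le_mul_of_pos_right _ hB
          _ = lam * (k + 1) * (2 * κ * (2 * κ * (1 + 2 * lam) + 2 * lam) + 1) ^ (k + 1) := by ring
      · -- `θ B^k ≤ B^(k+1)`
        calc 2 * κ * (2 * κ * (1 + 2 * lam) + 2 * lam) * (2 * κ * (2 * κ * (1 + 2 * lam) + 2 * lam) + 1) ^ k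
            ≤ (2 * κ * (2 * κ * (1 + 2 * lam) + 2 * lam) + 1) *
                (2 * κ * (2 * κ * (1 + 2 * lam) + 2 * lam) + 1) ^ k :=
              Nat.mul_le_mul_right _ (Nat.le_succ _)
          _ = (2 * κ * (2 * κ * (1 + 2 * lam) + 2 * lam) + 1) ^ (k + 1) := by ring

/-- The final arithmetic: `lam · L · B^L ≤ n^(B+2)` for `L = log₂ n + 1`, `1 ≤ B`, `lam·B + 1 ≤ n`. -/
theorem final_bound (lam B n : ℕ) (hB : 1 ≤ B) (hn : lam * B + 1 ≤ n) :
    lam * (Nat.log 2 n + 1) * B ^ (Nat.log 2 n + 1) ≤ n ^ (B + 2) := by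
  have hn0 : n ≠ 0 := by omega
  have hlog : Nat.log 2 n + 1 ≤ n := Nat.log_lt_self 2 hn0
  have hpow : 2 ^ Nat.log 2 n ≤ n := Nat.pow_log_le_self 2 hn0
  have hBpow : B ≤ 2 ^ B := (Nat.lt_two_pow_self).le
  have h1 : B ^ Nat.log 2 n ≤ n ^ B :=
    calc B ^ Nat.log 2 n ≤ (2 ^ B) ^ Nat.log 2 n := Nat.pow_le_pow_left hBpow _
      _ = (2 ^ Nat.log 2 n) ^ B := by rw [← pow_mul, ← pow_mul, mul_comm]
      _ ≤ n ^ B := Nat.pow_le_pow_left hpow _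
  have hlamB : lam * B ≤ n := by omega
  have _ := hB
  calc lam * (Nat.log 2 n + 1) * B ^ (Nat.log 2 n + 1)
      = (lam * B) * (Nat.log 2 n + 1) * B ^ Nat.log 2 n := by ring
    _ ≤ n * n * n ^ B := Nat.mul_le_mul (Nat.mul_le_mul hlamB hlog) h1
    _ = n ^ (B + 2) := by ring

/-- **Registered stub `stub_polyOfAbsoluteMerge` of `Lines/cell_union_merge.lean` (crux stmt-PneNP-18923), verbatim:
`AbsoluteMerge lam → JointCutLemma κ → PolyStableIdem` (both hypotheses and the conclusion unfolded).**
Given `n` (eventually: `n ≥ lam·B + 1`), take `L = log₂ n + 1` (`n ≤ 2^L`), pull the level-`L` statement back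
to `Fin n` (padding by zero idempotents), apply it to the one-block family `E`, and let `E'_i` be the union of the
cells under `E_i`: these are commuting idempotents (unions of ONE exact system multiply by intersection) within
rank `lam·L·B^L·t ≤ n^(B+2)·t` of the `E_i`. -/
theorem stub_polyOfAbsoluteMerge :
    ∀ lam κ : ℕ,
    (∀ (K : Type) [Field K] [CharZero K] (d : ℕ) (X Y : Type) [Fintype X] [Fintype Y]
      (P : X → Matrix (Fin d) (Fin d) K) (Q : Y → Matrix (Fin d) (Fin d) K) (c : ℕ),
      (∀ x, P x * P x = P x) → (∀ x x', x ≠ x' → P x * P x' = 0) → ∑ x, P x = 1 →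
      (∀ y, Q y * Q y = Q y) → (∀ y y', y ≠ y' → Q y * Q y' = 0) → ∑ y, Q y = 1 →
      (∀ (A : Finset X) (B : Finset Y),
        ((∑ x ∈ A, P x) * (∑ y ∈ B, Q y) - (∑ y ∈ B, Q y) * (∑ x ∈ A, P x)).rank ≤ c) →
      ∃ (P' : X → Matrix (Fin d) (Fin d) K) (Q' : Y → Matrix (Fin d) (Fin d) K),
        (∀ x, P' x * P' x = P' x) ∧ (∀ x x', x ≠ x' → P' x * P' x' = 0) ∧ ∑ x, P' x = 1 ∧
        (∀ y, Q' y * Q' y = Q' y) ∧ (∀ y y', y ≠ y' → Q' y * Q' y' = 0) ∧ ∑ y, Q' y = 1 ∧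
        (∀ x y, P' x * Q' y = Q' y * P' x) ∧
        (∀ A : Finset X, ((∑ x ∈ A, P x) - ∑ x ∈ A, P' x).rank ≤ lam * c) ∧
        (∀ B : Finset Y, ((∑ y ∈ B, Q y) - ∑ y ∈ B, Q' y).rank ≤ lam * c)) →
    (∀ (K : Type) [Field K] (d : ℕ) (X Y : Type) [Fintype X] [Fintype Y]
      (P : X → Matrix (Fin d) (Fin d) K) (Q : Y → Matrix (Fin d) (Fin d) K) (G : Matrix (Fin d) (Fin d) K) (u v : ℕ),
      (∀ x, P x * P x = P x) → (∀ x x', x ≠ x' → P x * P x' = 0) → ∑ x, P x = 1 →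
      (∀ y, Q y * Q y = Q y) → (∀ y y', y ≠ y' → Q y * Q y' = 0) → ∑ y, Q y = 1 →
      (∀ x y, P x * Q y = Q y * P x) →
      (∀ A : Finset X, ((∑ x ∈ A, P x) * G - G * ∑ x ∈ A, P x).rank ≤ u) →
      (∀ B : Finset Y, ((∑ y ∈ B, Q y) * G - G * ∑ y ∈ B, Q y).rank ≤ v) →
      ∀ C : Finset (X × Y),
        ((∑ p ∈ C, P p.1 * Q p.2) * G - G * ∑ p ∈ C, P p.1 * Q p.2).rank ≤ κ * (u + v)) →
    ∃ a : ℕ, ∀ᶠ n : ℕ in atTop, ∀ (K : Type) [Field K] [CharZero K] (d t : ℕ)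
      (E : Fin n → Matrix (Fin d) (Fin d) K), (∀ i, E i * E i = E i) →
      (∀ i j, (E i * E j - E j * E i).rank ≤ t) →
      ∃ E' : Fin n → Matrix (Fin d) (Fin d) K, (∀ i, E' i * E' i = E' i) ∧ (∀ i j, E' i * E' j = E' j * E' i) ∧
        ∀ i, (E i - E' i).rank ≤ n ^ a * t := by
  intro lam κ hA hJ
  refine ⟨2 * κ * (2 * κ * (1 + 2 * lam) + 2 * lam) + 1 + 2, ?_⟩
  rw [Filter.eventually_atTop]
  refine ⟨lam * (2 * κ * (2 * κ * (1 + 2 * lam) + 2 * lam) + 1) + 1, ?_⟩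
  intro n hn K _ _ d t E hE hc
  -- the dyadic level `L = log₂ n + 1`, `n ≤ 2^L`
  have hnL : n ≤ 2 ^ (Nat.log 2 n + 1) := (Nat.lt_pow_succ_log_self one_lt_two n).le
  obtain ⟨X, instX, A, hgood⟩ := level_all (K := K) (d := d) lam κ hA hJ t (Nat.log 2 n + 1)
  -- pull back to `Fin n` (padding) and apply to the one-block family
  have hgood' := level_transport A (Fin.castLE hnL) (Fin.castLE_injective hnL) le_rfl le_rfl hgood
  obtain ⟨P, hPid, hPor, -, hPcost, -⟩ :=
    hgood' Unit (fun _ => E) (fun _ i => hE i) (fun _ _ i j => hc i j)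
  classical
  refine ⟨fun i => ∑ x ∈ A (Fin.castLE hnL i), P () x, ?_, ?_, ?_⟩
  · intro i
    show (∑ x ∈ A (Fin.castLE hnL i), P () x) * (∑ x ∈ A (Fin.castLE hnL i), P () x) = _
    rw [cells_sum_mul_sum (P ()) (hPid ()) (hPor ()), Finset.inter_self]
  · intro i j
    show (∑ x ∈ A (Fin.castLE hnL i), P () x) * (∑ x ∈ A (Fin.castLE hnL j), P () x) =
      (∑ x ∈ A (Fin.castLE hnL j), P () x) * (∑ x ∈ A (Fin.castLE hnL i), P () x)
    rw [cells_sum_mul_sum (P ()) (hPid ()) (hPor ()), cells_sum_mul_sum (P ()) (hPid ()) (hPor ()),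
      Finset.inter_comm]
  · intro i
    refine (hPcost () i).trans (Nat.mul_le_mul_right _ ?_)
    exact final_bound lam _ n (Nat.le_add_left 1 _) hn

end Summit.PneNP.PneNP.Theorems.CnfIdealGenLengthRankDefectRepresentationsPolyOfAbsoluteMerge
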